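import Literature.AlgebraicGeometry.Morphisms.CechModuleRefinement
import HarnessLib

/-!
# Refinement maps on Čech `2`-cochains of a sheaf of modules (definition)

Sequel of `Literature/AlgebraicGeometry/Morphisms/CechModuleRefinement.lean` (refinement maps
`ρ : Čᵖ(𝒰, M) → Čᵖ(𝒱, M)`, `p ≤ 1`, for a map of families of opens `τ : 𝒱 → 𝒰`, `V_j ⊆ U_{τ j}`, of
an `A`-scheme `f : X → Spec A` and a sheaf of `𝒪_X`-modules `M`; Görtz–Wedhorn II (21.16),
Def. 21.71).  This file only adds the degree-`2` component

* `cechMRefineC2` — `(ρ e)_{jj'j''} = e_{τ j, τ j', τ j''}|_{V_j ∩ V_{j'} ∩ V_{j''}}`,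

with its unfolding lemma; that `ρ` is a map of complexes in degree `2` (`d¹ ∘ ρ = ρ ∘ d¹`), preserves
`2`-cocycles and `2`-coboundaries, and the contractibility of families containing their union are
proved in `CechModuleH2RefinementLemmas.lean` (kept separate so that this file is definition-only).
Everything is proved; no named facts. Mathlib searched (pin v4.32): no Čech refinement maps for
sheaves of modules (cf. `CechModuleRefinement.lean`).

## References

* U. Görtz, T. Wedhorn, *Algebraic Geometry II: Cohomology of Schemes*, Springer Spektrum (2023),
  doi:10.1007/978-3-658-43031-3: (21.16) Def. 21.71 and Lemma 21.72, p. 262. [GortzWedhorn2023]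
* The Stacks Project, Tag 09UY (refinements and Čech cohomology), Tag 01ED. [StacksProject]
-/

noncomputable section

open CategoryTheory AlgebraicGeometry Limits TopologicalSpace Opposite

universe u v w

namespace Literature.AlgebraicGeometry.Morphisms

variable {A : Type u} [CommRing A] {X : Scheme.{u}} (f : X ⟶ Spec (.of A)) (M : X.Modules)

section Refine

variable {ι : Type v} {ι' : Type w} (U : ι → X.Opens) (V : ι' → X.Opens) (τ : ι' → ι)
  (hτ : ∀ j, V j ≤ U (τ j))

/-- Refinement on `2`-cochains: `(ρ e)_{jj'j''} = e_{τ j, τ j', τ j''}|_{V_j ∩ V_{j'} ∩ V_{j''}}`.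
[cite: GortzWedhorn2023, (21.16) Def. 21.71 (p. 262)] -/
def cechMRefineC2 : CechMC2 f M U →ₗ[A] CechMC2 f M V where
  toFun e j j' j'' := MSections.res f M (inf_le_inf (inf_le_inf (hτ j) (hτ j')) (hτ j''))
    (e (τ j) (τ j') (τ j''))
  map_add' _ _ := funext fun _ => funext fun _ => funext fun _ => map_add _ _ _
  map_smul' a _ := funext fun _ => funext fun _ => funext fun _ => map_smul _ a _

/-- Unfolding of `cechMRefineC2`. [cite: GortzWedhorn2023, (21.16) Def. 21.71 (p. 262)] -/
theorem cechMRefineC2_apply (e : CechMC2 f M U) (j j' j'' : ι') :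
    cechMRefineC2 f M U V τ hτ e j j' j'' =
      MSections.res f M (inf_le_inf (inf_le_inf (hτ j) (hτ j')) (hτ j'')) (e (τ j) (τ j') (τ j'')) :=
  rfl

/-- Proof-irrelevance of the inclusions in `cechMRefineC1` (the map (21.16) depends only on `τ`).
[cite: GortzWedhorn2023, (21.16) Def. 21.71 (p. 262)] -/
theorem cechMRefineC1_eq (hτ' : ∀ j, V j ≤ U (τ j)) (c : CechMC1 f M U) :
    cechMRefineC1 f M U V τ hτ c = cechMRefineC1 f M U V τ hτ' c := rfl

/-- Proof-irrelevance of the inclusions in `cechMRefineC2` (the map (21.16) depends only on `τ`).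
[cite: GortzWedhorn2023, (21.16) Def. 21.71 (p. 262)] -/
theorem cechMRefineC2_eq (hτ' : ∀ j, V j ≤ U (τ j)) (e : CechMC2 f M U) :
    cechMRefineC2 f M U V τ hτ e = cechMRefineC2 f M U V τ hτ' e := rfl

end Refine

end Literature.AlgebraicGeometry.Morphisms

end
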